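import Summits.BirchSwinnertonDyer.BirchSwinnertonDyer.Theorems.EisensteinPrimesMazurMCOnCellBTwistbackSubrowEvaluatedBalance
import Summits.BirchSwinnertonDyer.BirchSwinnertonDyer.Theorems.EisensteinPrimesMazurMCOnCellBTwistbackQuadraticRadical
import Summits.BirchSwinnertonDyer.Rank1Residual.Additive.X3BranchLineCharacterPrimeDisc
import HarnessLib

/-!
# Crux 3 `MazurMCOnCellB` (stmt-BirchSwinnertonDyer-19033), line `twistback` v5/v6 — the sub-row doors WITHOUT THE
# QUOTIENT CHARACTER and, for an odd kernel discriminant, WITHOUT ANY CHARACTER: stub 6′'s (∃-PARTNER) conclusion at a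
# non-split X2b pair `(W, 3)` from a rational `3`-line `Φ₀`, its kernel discriminant `D ≡ 1 (mod 4)` and ONE identity in
# reduction types, residues and Jacobi symbols (part 3 of `…LocalBalanceAtUnramifiedPlace`)

Width seat bsd-line-x2-p1-w7 (gen 2), cell `bsd-eis` (run/shared/lean/pub/bsd-eis/), 2026-08-28. HONEST FRAMING: CONDITIONAL
doors; named facts BY NAME exactly as in w3 g11's p661280 `…TwistbackSubrowPartnerAnyLinePAdicGZ` / w3 g10's p657428
(the route's `PublishedInputs` stmt-…-19037; Disegni 2020 Thm. 4(1) `padicBSD_rankOne_nonsplitMult` and Thm. 2.4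
`padicGrossZagier_nonsplitMult`; Greenberg–Vatsal Thm. (3.11); Nakagawa–Horie 1988 + Taya 2000 — PUBLISHED;
Dokchitser–Dokchitser + Keller–Yin Thm. E (PRE) only in the `_of_thmE` door). THEOREMS ONLY (no `def`, no named fact
introduced, no `sorry`); `--supports` stmt-BirchSwinnertonDyer-19033; closes no stub by itself; nothing about any curve is
proved unconditionally; no summit statement, no Mazur main conjecture and no BSD is proved for any curve; 0 cells / labels
/ tiers move.

WHY. On the CLOSED sub-row «`p = 3`, `3` non-split, local balance `1`» of crux 3 (30/127 A10 cells by the cell's census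
CA-g9-1; v6 `upperPartner_onSubrow`, PUB + Keller–Yin Thm. D) the per-pair input is ONE identity for a rational `3`-line
`Φ₀ ≤ W[3]` presented by primitive characters `φ` (mod `m`) on the line and `ψ` (mod `d`) on the quotient. Parts 1–2
(p662143, p662641) evaluated every term except `2s_ℓ[ψ(ℓ) = 1]` at the additive places with `ℓ ∤ m`, `ℓ ≡ 1 (mod 3)`.
This file removes the remaining character COMPUTATIONS from the per-pair certificate:

* §1 `balance_iff_lineChar_at_three` — at those places `φ(ℓ) = ψ(ℓ)` (part 1
  `balanceTerm_eq_two_mul_of_mod_three_eq_one`), so the identity reads in the LINE character alone: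
  `n = Σ_{S₀∖A} s_ℓ[split] + Σ_{v∈A} (0 if ℓ ∣ m | s_ℓ if ℓ % 3 = 2 | 2s_ℓ[φ(ℓ) = 1])`.
* §2 `upperPartner_at_three_of_lineCharBalance_of_padicGZ` (PUB-only) / `_of_thmE` — the doors with `(Φ₀, φ)` and that
  identity ONLY: the quotient character is supplied ABSTRACTLY inside by the tree's Kronecker–Weber
  `ResidualLineCharacters.exists_character_quot` (never computed per pair).
* §3 `upperPartner_at_three_of_kernelRadical_of_padicGZ` — `φ` itself from the tree's quadratic Kronecker–Weber for a
  line (`X3Branch.smul_eq_quadraticCharacter_of_kernel_sqrt`): data = a quadratic `ℤ`-valued character `χ` mod `N` with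
  `χ̄ = χ mod 3` primitive, a radical `s ≠ 0` with `τ • s = χ(χ_N τ)·s`, and «`σ` fixes `Φ₀` pointwise iff `σ • s = s`»;
  identity with `[χ(ℓ) = 1]` (`ringHomComp_eq_one_iff`: `χ̄(a) = 1 ↔ χ(a) = 1` for a quadratic `χ`).
* §4 `upperPartner_at_three_of_kernelDisc_of_padicGZ` — the CHARACTER-FREE door for an ODD kernel discriminant: data =
  the rational `3`-line `Φ₀`, an integer `D ≡ 1 (mod 4)` with `|D|` squarefree and the KERNEL-DISCRIMINANT property
  «`σ` fixes `Φ₀` pointwise iff `σ√D = √D`» (the tree's `EisensteinKernelDiscriminant.exists_kernelDisc` /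
  `exists_disc_of_mem`: `D` = squarefree part of `4x₀³ + b₂x₀² + 2b₄x₀ + b₆` at a rational root `x₀` of `Ψ₃` — LEAD g9's
  table columns), the finite sets `S₀ ⊇ A` with reduction types, and the identity
  `1 = Σ_{S₀∖A} s_ℓ[split] + Σ_{v∈A} (0 if ℓ ∣ |D| | s_ℓ if ℓ % 3 = 2 | 2s_ℓ[J(ℓ | |D|) = 1])` — every symbol decidable
  (`sFactor`, `%`, `∣`, Mathlib's `jacobiSym`); the character is w3 g8's explicit quadratic Kronecker–Weber
  `exists_quadraticChar_geomSqrt_of_emod_four` (`χ(a) = J(a | |D|)`, `χ̄` primitive). `D = 1` (a rational `3`-torsion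
  point) is the case `N = 1`. NOT here: even kernel discriminants (`χ₄`, `χ₈` supplements: tree
  `Rat.exists_sqrt_neg_one_smul_eq_chi4`, `X3BranchLineCharacterSqrtTwo`).

WHAT THIS GIVES (per-pair format for the sub-row, said not filed — W-71): a cell `(W, 3)` of the sub-row is an instance of
§4 from (i) `X2.CellB W 3` and `3` non-split [instrument reading `r_an = 0` + kernel facts], (ii) a kernel-polynomial
certificate for `Φ₀` (templates `exists_isRationalLine_<label>`), (iii) `D` with the kernel-discriminant property
(`exists_disc_of_mem` shape), (iv) reduction types at the bad places `≠ 3`, (v) `decide`/`norm_num` on the identity.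

References: [GreenbergVatsal2000] §2 Prop. (2.4) (p. 22), p. 28, §3 Thm. (3.11) and p. 43; [Washington1997] Ch. 3;
[IrelandRosen1990] Ch. 6 Prop. 6.3.2; [Cox2013] §1.C; [Disegni2020] §2.2 Thm. 2.4 and §3.2 Thm. 4; [KellerYin2024] Thm. E
(PRE; hypothesis of one door); [NakagawaHorie1988] Thm. 1.
-/

set_option autoImplicit false
-- `Summit.BirchSwinnertonDyer.BirchSwinnertonDyer.…`: the summit and its single sub-problem share a name.
set_option linter.dupNamespace false

noncomputable section

open scoped Classical NumberTheorySymbols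

open NumberField IsDedekindDomain Field WeierstrassCurve DirichletCharacter
  Literature.NumberTheory.EllipticCurves Literature.NumberTheory.GaloisRepresentations
  Literature.NumberTheory.EllipticCurves.GreenbergVatsal2000
  Literature.NumberTheory.EllipticCurves.Rank1Residual Literature.NumberTheory.EllipticCurves.Rank1Residual.Typed
  Literature.NumberTheory.EllipticCurves.Disegni2020 Literature.NumberTheory.EllipticCurves.KellerYin2024
  Summit.BirchSwinnertonDyer.Rank1Residual Summit.BirchSwinnertonDyer.Rank1Residual.X2
  Summit.BirchSwinnertonDyer.Rank1Residual.Additive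
  Summit.BirchSwinnertonDyer.BirchSwinnertonDyer.Theses
  Summit.BirchSwinnertonDyer.BirchSwinnertonDyer.Theorems.EisensteinPrimesLineCharactersUnramifiedAtMultiplicativePlace
  Summit.BirchSwinnertonDyer.BirchSwinnertonDyer.Theorems.EisensteinPrimesLocalBalanceAtUnramifiedPlace
  Summit.BirchSwinnertonDyer.BirchSwinnertonDyer.Theorems.EisensteinPrimesMazurMCOnCellBTwistbackSubrowEvaluatedBalance
  Summit.BirchSwinnertonDyer.BirchSwinnertonDyer.Theorems.EisensteinPrimesMazurMCOnCellBTwistbackSubrowPartnerAnyLine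
  Summit.BirchSwinnertonDyer.BirchSwinnertonDyer.Theorems.EisensteinPrimesMazurMCOnCellBTwistbackSubrowPartnerAnyLinePAdicGZ
  Summit.BirchSwinnertonDyer.BirchSwinnertonDyer.Theorems.EisensteinPrimesMazurMCOnCellBTwistbackQuadraticRadical

namespace Summit.BirchSwinnertonDyer.BirchSwinnertonDyer.Theorems.EisensteinPrimesMazurMCOnCellBTwistbackSubrowLineCharBalance

variable {W : WeierstrassCurve ℚ} [W.IsElliptic] {Φ₃ : AddSubgroup (geomTorsion W (3 : ℤ))}
  {m : ℕ} [NeZero m] {φ₃ : DirichletCharacter (ZMod 3) m} {d : ℕ} [NeZero d] {ψ₃ : DirichletCharacter (ZMod 3) d}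

/-! ## §1. The evaluated balance in the LINE character alone -/

/-- **The evaluated balance (`p = 3`) written in the LINE character `φ` only.** As part 1's
`balance_iff_evaluated_at_three`, but the last additive term reads `2s_ℓ[φ(ℓ) = 1]` instead of `2s_ℓ[ψ(ℓ) = 1]`:
at an additive place with `ℓ ∤ m` and `ℓ ≡ 1 (mod 3)` the two presenting characters AGREE at `ℓ`
(`balanceTerm_eq_two_mul_of_mod_three_eq_one`). So the quotient character enters the sub-row identity NOWHERE.
[cite: GreenbergVatsal2000, §2 Prop. (2.4) (p. 22), p. 28 (φψ = ω) and §3 p. 43] -/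
theorem balance_iff_lineChar_at_three [W.IsGloballyMinimal] {S₀ A : Finset (HeightOneSpectrum (𝓞 ℚ))}
    (hAS : A ⊆ S₀) (hS₀p : ∀ v ∈ S₀, ((3 : ℕ) : 𝓞 ℚ) ∉ v.asIdeal)
    (hA : ∀ v ∈ A, W.HasAdditiveReductionAt v)
    (hmult : ∀ v ∈ S₀, v ∉ A → W.HasMultiplicativeReductionAt v)
    (hΦ : IsRationalLine W 3 Φ₃) (hφ : φ₃.IsPrimitive) (hψ : ψ₃.IsPrimitive)
    (hφ0 : ∀ (σ : absoluteGaloisGroup ℚ), ∀ P ∈ Φ₃,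
      σ • P = (φ₃ ((modNCyclotomicCharacter ℚ m σ : (ZMod m)ˣ) : ZMod m)).val • P)
    (hψ0 : ∀ (σ : absoluteGaloisGroup ℚ) (Q : geomTorsion W (3 : ℤ)),
      σ • Q - (ψ₃ ((modNCyclotomicCharacter ℚ d σ : (ZMod d)ˣ) : ZMod d)).val • Q ∈ Φ₃) (n : ℕ) :
    (n + ∑ v ∈ S₀, delta W 3 v =
      ∑ v ∈ S₀, ((if φ₃ (Rat.HeightOneSpectrum.natGenerator v : ZMod m) =
            (Rat.HeightOneSpectrum.natGenerator v : ZMod 3)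
          then sFactor 3 (Rat.HeightOneSpectrum.natGenerator v) else 0) +
        (if ψ₃ (Rat.HeightOneSpectrum.natGenerator v : ZMod d) =
            (Rat.HeightOneSpectrum.natGenerator v : ZMod 3)
          then sFactor 3 (Rat.HeightOneSpectrum.natGenerator v) else 0))) ↔
    (n = ∑ v ∈ S₀ \ A, (if W.HasSplitMultiplicativeReductionAt v
          then sFactor 3 (Rat.HeightOneSpectrum.natGenerator v) else 0) +
      ∑ v ∈ A, (if Rat.HeightOneSpectrum.natGenerator v ∣ m then 0 else
        if Rat.HeightOneSpectrum.natGenerator v % 3 = 2 then sFactor 3 (Rat.HeightOneSpectrum.natGenerator v)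
        else 2 * (if φ₃ (Rat.HeightOneSpectrum.natGenerator v : ZMod m) = 1
          then sFactor 3 (Rat.HeightOneSpectrum.natGenerator v) else 0))) := by
  haveI : Fact (Nat.Prime 3) := ⟨Nat.prime_three⟩
  rw [balance_iff_evaluated_at_three hAS hS₀p hA hmult hΦ hφ hψ hφ0 hψ0 n]
  have hT : ∑ v ∈ A, (if Rat.HeightOneSpectrum.natGenerator v ∣ m then 0 else
        if Rat.HeightOneSpectrum.natGenerator v % 3 = 2 then sFactor 3 (Rat.HeightOneSpectrum.natGenerator v)
        else 2 * (if ψ₃ (Rat.HeightOneSpectrum.natGenerator v : ZMod d) = 1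
          then sFactor 3 (Rat.HeightOneSpectrum.natGenerator v) else 0)) =
      ∑ v ∈ A, (if Rat.HeightOneSpectrum.natGenerator v ∣ m then 0 else
        if Rat.HeightOneSpectrum.natGenerator v % 3 = 2 then sFactor 3 (Rat.HeightOneSpectrum.natGenerator v)
        else 2 * (if φ₃ (Rat.HeightOneSpectrum.natGenerator v : ZMod m) = 1
          then sFactor 3 (Rat.HeightOneSpectrum.natGenerator v) else 0)) := by
    refine Finset.sum_congr rfl fun v hv ↦ ?_
    by_cases hℓm : Rat.HeightOneSpectrum.natGenerator v ∣ m
    · rw [if_pos hℓm, if_pos hℓm]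
    · rw [if_neg hℓm, if_neg hℓm]
      by_cases h2 : Rat.HeightOneSpectrum.natGenerator v % 3 = 2
      · rw [if_pos h2, if_pos h2]
      · rw [if_neg h2, if_neg h2]
        have hℓ3 : Rat.HeightOneSpectrum.natGenerator v ≠ 3 := fun h ↦
          not_natGenerator_dvd (p := 3) (hS₀p v (hAS hv)) (h ▸ dvd_rfl)
        have hℓ := Rat.HeightOneSpectrum.prime_natGenerator v
        have h1 : Rat.HeightOneSpectrum.natGenerator v % 3 = 1 := by
          have hne : Rat.HeightOneSpectrum.natGenerator v % 3 ≠ 0 := by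
            intro h0
            exact hℓ3 ((Nat.prime_dvd_prime_iff_eq Nat.prime_three hℓ).mp (Nat.dvd_of_mod_eq_zero h0)).symm
          omega
        have heq := (balanceTerm_eq_two_mul_of_mod_three_eq_one hΦ hφ hψ hφ0 hψ0 hℓ hℓm
          ((natCast_zmod_three_eq_iff _).2.mpr h1) 0).1
        rw [heq]
  rw [hT]

/-! ## §2. The doors with the line character only (quotient character abstract) -/

/-- **Stub 6 (∃-PARTNER) at a non-split X2b pair `(W, 3)` from `(Φ₀, φ)` and the line-character balance, PUBLISHED
inputs only (`_of_padicGZ`).** Data: `X2.CellB W 3`, `3` non-split; a rational `3`-line `Φ₀` with a PRIMITIVE presenting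
character `φ` mod `m` (`hφ0`); `S₀ ∌ (3)` finite with `W` good off `S₀ ∪ {3}`, `A ⊆ S₀` additive, `S₀ ∖ A` multiplicative;
the identity `1 = Σ_{S₀∖A} s_ℓ[split] + Σ_{v∈A}(0 if ℓ ∣ m | s_ℓ if ℓ % 3 = 2 | 2s_ℓ[φ(ℓ)=1])`. The quotient character is
taken from `ResidualLineCharacters.exists_character_quot` inside. Named facts BY NAME as in p661280: `PublishedInputs`,
Disegni Thm. 4(1), GV Thm. (3.11), Disegni Thm. 2.4, Nakagawa–Horie–Taya — all PUBLISHED. Conditional.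
[cite: Disegni2020, §2.2 Thm. 2.4 and §3.2 Thm. 4] [cite: GreenbergVatsal2000, Thm. (1.3), §2 p. 28, §3 Thm. (3.11)]
[cite: NakagawaHorie1988, Thm. 1] -/
theorem upperPartner_at_three_of_lineCharBalance_of_padicGZ (hP : EisensteinPrimes.PublishedInputs)
    (hDis : padicBSD_rankOne_nonsplitMult) (h311 : thm311_hasUnitContent_iff_and_order_eq_of_lineRamifiedEven)
    (hDGZ : padicGrossZagier_nonsplitMult)
    (hNH : Literature.NumberTheory.QuadraticFields.nakagawaHorie_taya_exists_imaginary_h3_eq_one)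
    (W : WeierstrassCurve ℚ) [W.IsElliptic] [W.IsGloballyMinimal]
    (hc : X2.CellB W 3) (hns : ¬ W.HasSplitMultiplicativeReductionAtPrime 3)
    {Φ₀ : AddSubgroup (geomTorsion W (3 : ℤ))} (hΦ : IsRationalLine W 3 Φ₀)
    {m : ℕ} [NeZero m] (φ : DirichletCharacter (ZMod 3) m) (hφ : φ.IsPrimitive)
    (hφ0 : ∀ (σ : absoluteGaloisGroup ℚ), ∀ P ∈ Φ₀,
      σ • P = (φ ((modNCyclotomicCharacter ℚ m σ : (ZMod m)ˣ) : ZMod m)).val • P)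
    (S₀ : Finset (HeightOneSpectrum (𝓞 ℚ))) (hS₀p : ∀ v ∈ S₀, ((3 : ℕ) : 𝓞 ℚ) ∉ v.asIdeal)
    (hS : ∀ v : HeightOneSpectrum (𝓞 ℚ), v ∉ S₀ → ((3 : ℕ) : 𝓞 ℚ) ∉ v.asIdeal → W.HasGoodReductionAt v)
    (A : Finset (HeightOneSpectrum (𝓞 ℚ))) (hAS : A ⊆ S₀) (hA : ∀ v ∈ A, W.HasAdditiveReductionAt v)
    (hmult : ∀ v ∈ S₀, v ∉ A → W.HasMultiplicativeReductionAt v)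
    (hbal : 1 = ∑ v ∈ S₀ \ A, (if W.HasSplitMultiplicativeReductionAt v
          then sFactor 3 (Rat.HeightOneSpectrum.natGenerator v) else 0) +
      ∑ v ∈ A, (if Rat.HeightOneSpectrum.natGenerator v ∣ m then 0 else
        if Rat.HeightOneSpectrum.natGenerator v % 3 = 2 then sFactor 3 (Rat.HeightOneSpectrum.natGenerator v)
        else 2 * (if φ (Rat.HeightOneSpectrum.natGenerator v : ZMod m) = 1
          then sFactor 3 (Rat.HeightOneSpectrum.natGenerator v) else 0))) :
    ∃ (K : Type) (_ : Field K) (_ : NumberField K), IsImaginaryQuadratic K ∧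
      SatisfiesHeegnerHypothesis (W.conductorNorm ℤ) K ∧ SatisfiesHeegnerHypothesis 3 K ∧
      Odd (NumberField.discr K) ∧ NumberField.discr K < -4 ∧
      (W.quadraticTwist (NumberField.discr K : ℚ)).analyticRank = 1 ∧
      ∀ (Wd : WeierstrassCurve ℚ) [Wd.IsElliptic] [Wd.IsGloballyMinimal],
        (∃ C : VariableChange ℚ, C • Wd = W.quadraticTwist (NumberField.discr K : ℚ)) →
        MissingUpperBoundAt Wd 3 := by
  haveI : Fact (Nat.Prime 3) := ⟨Nat.prime_three⟩
  obtain ⟨d, _, ψ, hψ, -, hψ0⟩ := ResidualLineCharacters.exists_character_quot hΦ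
  exact upperPartner_at_three_of_line_of_padicGZ hP hDis h311 hDGZ hNH W hc hns hΦ φ ψ hφ hψ hφ0 hψ0 S₀ hS₀p hS
    ((balance_iff_lineChar_at_three hAS hS₀p hA hmult hΦ hφ hψ hφ0 hψ0 1).mpr hbal)

/-- **The same door over Keller–Yin Thm. E (`_of_thmE`)** — p657428's sourcing (Dokchitser–Dokchitser PUB + Keller–Yin
Thm. E PRE instead of Disegni Thm. 2.4), for the record of v5. Conditional. [claim: KellerYin2024, status: under-review]
[cite: GreenbergVatsal2000, Thm. (1.3), §2 p. 28, §3 Thm. (3.11)] [cite: Disegni2020, Thm. 4 (§3.2)]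
[cite: DokchitserDokchitserAnnals2010, Thm. 1.4] [cite: NakagawaHorie1988, Thm. 1] -/
theorem upperPartner_at_three_of_lineCharBalance_of_thmE (hP : EisensteinPrimes.PublishedInputs)
    (hDis : padicBSD_rankOne_nonsplitMult) (h311 : thm311_hasUnitContent_iff_and_order_eq_of_lineRamifiedEven)
    (hDD : ∀ (V : WeierstrassCurve ℚ) [V.IsElliptic] (ℓ : ℕ) [Fact ℓ.Prime], selmerCorank_mod_two_eq V ℓ)
    (hKY : thmE_pConverse_semistable_OPEN)
    (hNH : Literature.NumberTheory.QuadraticFields.nakagawaHorie_taya_exists_imaginary_h3_eq_one)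
    (W : WeierstrassCurve ℚ) [W.IsElliptic] [W.IsGloballyMinimal]
    (hc : X2.CellB W 3) (hns : ¬ W.HasSplitMultiplicativeReductionAtPrime 3)
    {Φ₀ : AddSubgroup (geomTorsion W (3 : ℤ))} (hΦ : IsRationalLine W 3 Φ₀)
    {m : ℕ} [NeZero m] (φ : DirichletCharacter (ZMod 3) m) (hφ : φ.IsPrimitive)
    (hφ0 : ∀ (σ : absoluteGaloisGroup ℚ), ∀ P ∈ Φ₀,
      σ • P = (φ ((modNCyclotomicCharacter ℚ m σ : (ZMod m)ˣ) : ZMod m)).val • P)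
    (S₀ : Finset (HeightOneSpectrum (𝓞 ℚ))) (hS₀p : ∀ v ∈ S₀, ((3 : ℕ) : 𝓞 ℚ) ∉ v.asIdeal)
    (hS : ∀ v : HeightOneSpectrum (𝓞 ℚ), v ∉ S₀ → ((3 : ℕ) : 𝓞 ℚ) ∉ v.asIdeal → W.HasGoodReductionAt v)
    (A : Finset (HeightOneSpectrum (𝓞 ℚ))) (hAS : A ⊆ S₀) (hA : ∀ v ∈ A, W.HasAdditiveReductionAt v)
    (hmult : ∀ v ∈ S₀, v ∉ A → W.HasMultiplicativeReductionAt v)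
    (hbal : 1 = ∑ v ∈ S₀ \ A, (if W.HasSplitMultiplicativeReductionAt v
          then sFactor 3 (Rat.HeightOneSpectrum.natGenerator v) else 0) +
      ∑ v ∈ A, (if Rat.HeightOneSpectrum.natGenerator v ∣ m then 0 else
        if Rat.HeightOneSpectrum.natGenerator v % 3 = 2 then sFactor 3 (Rat.HeightOneSpectrum.natGenerator v)
        else 2 * (if φ (Rat.HeightOneSpectrum.natGenerator v : ZMod m) = 1
          then sFactor 3 (Rat.HeightOneSpectrum.natGenerator v) else 0))) :
    ∃ (K : Type) (_ : Field K) (_ : NumberField K), IsImaginaryQuadratic K ∧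
      SatisfiesHeegnerHypothesis (W.conductorNorm ℤ) K ∧ SatisfiesHeegnerHypothesis 3 K ∧
      Odd (NumberField.discr K) ∧ NumberField.discr K < -4 ∧
      (W.quadraticTwist (NumberField.discr K : ℚ)).analyticRank = 1 ∧
      ∀ (Wd : WeierstrassCurve ℚ) [Wd.IsElliptic] [Wd.IsGloballyMinimal],
        (∃ C : VariableChange ℚ, C • Wd = W.quadraticTwist (NumberField.discr K : ℚ)) →
        MissingUpperBoundAt Wd 3 := by
  haveI : Fact (Nat.Prime 3) := ⟨Nat.prime_three⟩
  obtain ⟨d, _, ψ, hψ, -, hψ0⟩ := ResidualLineCharacters.exists_character_quot hΦ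
  exact upperPartner_at_three_of_line_of_thmE hP hDis h311 hDD hKY hNH W hc hns hΦ φ ψ hφ hψ hφ0 hψ0 S₀ hS₀p hS
    ((balance_iff_lineChar_at_three hAS hS₀p hA hmult hΦ hφ hψ hφ0 hψ0 1).mpr hbal)

/-! ## §3. The line character from a kernel radical (quadratic Kronecker–Weber for the line) -/

/-- For a quadratic `ℤ`-valued character `χ`, its reduction `χ̄ = χ mod 3` takes the value `1` exactly where `χ` does
(`χ(a) ∈ {0, 1, −1}` and `−1 ≢ 1`, `0 ≢ 1 (mod 3)`). [folklore] -/
theorem ringHomComp_eq_one_iff {N : ℕ} (χ : MulChar (ZMod N) ℤ) (hχ2 : χ.IsQuadratic) (a : ZMod N) :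
    (χ.ringHomComp (Int.castRingHom (ZMod 3)) : DirichletCharacter (ZMod 3) N) a = 1 ↔ χ a = 1 := by
  rw [MulChar.ringHomComp_apply]
  rcases hχ2 a with h | h | h <;> rw [h] <;> decide

/-- **Stub 6 (∃-PARTNER) at a non-split X2b pair `(W, 3)` from a KERNEL RADICAL, PUBLISHED inputs only.** Data:
`X2.CellB W 3`, `3` non-split; a rational `3`-line `Φ₀`; a quadratic `ℤ`-valued character `χ` modulo `N` whose reduction
`χ̄ = χ mod 3` is PRIMITIVE; a radical `s ≠ 0` in `ℚ̄` with `τ • s = χ(χ_N τ)·s`; the kernel relation «`σ` fixes `Φ₀`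
pointwise iff `σ • s = s`»; `S₀`, `A` as in §2; the identity
`1 = Σ_{S₀∖A} s_ℓ[split] + Σ_{v∈A}(0 if ℓ ∣ N | s_ℓ if ℓ % 3 = 2 | 2s_ℓ[χ(ℓ) = 1])`. Then `φ = χ̄` presents the line
(`X3Branch.smul_eq_quadraticCharacter_of_kernel_sqrt`) and §2 applies. Conditional.
[cite: GreenbergVatsal2000, §2 p. 28 (the character φ of Φ)] [cite: Washington1997, Ch. 3]
[cite: Disegni2020, §2.2 Thm. 2.4 and §3.2 Thm. 4] [cite: NakagawaHorie1988, Thm. 1] -/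
theorem upperPartner_at_three_of_kernelRadical_of_padicGZ (hP : EisensteinPrimes.PublishedInputs)
    (hDis : padicBSD_rankOne_nonsplitMult) (h311 : thm311_hasUnitContent_iff_and_order_eq_of_lineRamifiedEven)
    (hDGZ : padicGrossZagier_nonsplitMult)
    (hNH : Literature.NumberTheory.QuadraticFields.nakagawaHorie_taya_exists_imaginary_h3_eq_one)
    (W : WeierstrassCurve ℚ) [W.IsElliptic] [W.IsGloballyMinimal]
    (hc : X2.CellB W 3) (hns : ¬ W.HasSplitMultiplicativeReductionAtPrime 3)
    {Φ₀ : AddSubgroup (geomTorsion W (3 : ℤ))} (hΦ : IsRationalLine W 3 Φ₀)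
    {N : ℕ} [NeZero N] (χ : MulChar (ZMod N) ℤ) (hχ2 : χ.IsQuadratic)
    (hprim : DirichletCharacter.IsPrimitive
      (χ.ringHomComp (Int.castRingHom (ZMod 3)) : DirichletCharacter (ZMod 3) N))
    {s : AlgebraicClosure ℚ} (hs0 : s ≠ 0)
    (hs : ∀ τ : absoluteGaloisGroup ℚ,
      τ • s = ((χ (modNCyclotomicCharacter ℚ N τ : ZMod N) : ℤ) : AlgebraicClosure ℚ) * s)
    (hker : ∀ σ : absoluteGaloisGroup ℚ, (∀ Q ∈ Φ₀, σ • Q = Q) ↔ σ • s = s)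
    (S₀ : Finset (HeightOneSpectrum (𝓞 ℚ))) (hS₀p : ∀ v ∈ S₀, ((3 : ℕ) : 𝓞 ℚ) ∉ v.asIdeal)
    (hS : ∀ v : HeightOneSpectrum (𝓞 ℚ), v ∉ S₀ → ((3 : ℕ) : 𝓞 ℚ) ∉ v.asIdeal → W.HasGoodReductionAt v)
    (A : Finset (HeightOneSpectrum (𝓞 ℚ))) (hAS : A ⊆ S₀) (hA : ∀ v ∈ A, W.HasAdditiveReductionAt v)
    (hmult : ∀ v ∈ S₀, v ∉ A → W.HasMultiplicativeReductionAt v)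
    (hbal : 1 = ∑ v ∈ S₀ \ A, (if W.HasSplitMultiplicativeReductionAt v
          then sFactor 3 (Rat.HeightOneSpectrum.natGenerator v) else 0) +
      ∑ v ∈ A, (if Rat.HeightOneSpectrum.natGenerator v ∣ N then 0 else
        if Rat.HeightOneSpectrum.natGenerator v % 3 = 2 then sFactor 3 (Rat.HeightOneSpectrum.natGenerator v)
        else 2 * (if χ (Rat.HeightOneSpectrum.natGenerator v : ZMod N) = 1
          then sFactor 3 (Rat.HeightOneSpectrum.natGenerator v) else 0))) :
    ∃ (K : Type) (_ : Field K) (_ : NumberField K), IsImaginaryQuadratic K ∧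
      SatisfiesHeegnerHypothesis (W.conductorNorm ℤ) K ∧ SatisfiesHeegnerHypothesis 3 K ∧
      Odd (NumberField.discr K) ∧ NumberField.discr K < -4 ∧
      (W.quadraticTwist (NumberField.discr K : ℚ)).analyticRank = 1 ∧
      ∀ (Wd : WeierstrassCurve ℚ) [Wd.IsElliptic] [Wd.IsGloballyMinimal],
        (∃ C : VariableChange ℚ, C • Wd = W.quadraticTwist (NumberField.discr K : ℚ)) →
        MissingUpperBoundAt Wd 3 := by
  haveI : Fact (Nat.Prime 3) := ⟨Nat.prime_three⟩
  have hφ0 : ∀ (σ : absoluteGaloisGroup ℚ), ∀ P ∈ Φ₀,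
      σ • P = ((χ.ringHomComp (Int.castRingHom (ZMod 3)) : DirichletCharacter (ZMod 3) N)
        ((modNCyclotomicCharacter ℚ N σ : (ZMod N)ˣ) : ZMod N)).val • P :=
    fun σ P hP ↦ X3Branch.smul_eq_quadraticCharacter_of_kernel_sqrt hΦ χ hχ2 hs0 hs hker σ P hP
  refine upperPartner_at_three_of_lineCharBalance_of_padicGZ hP hDis h311 hDGZ hNH W hc hns hΦ
    (χ.ringHomComp (Int.castRingHom (ZMod 3)) : DirichletCharacter (ZMod 3) N) hprim hφ0 S₀ hS₀p hS A hAS hA hmult ?_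
  rw [hbal]
  congr 1
  refine Finset.sum_congr rfl fun v _ ↦ ?_
  have hiff := ringHomComp_eq_one_iff χ hχ2 (Rat.HeightOneSpectrum.natGenerator v : ZMod N)
  by_cases h1 : χ (Rat.HeightOneSpectrum.natGenerator v : ZMod N) = 1
  · rw [if_pos h1, if_pos (hiff.mpr h1)]
  · rw [if_neg h1, if_neg (fun h ↦ h1 (hiff.mp h))]

/-! ## §4. Odd kernel discriminant: the CHARACTER-FREE door -/

/-- **Stub 6 (∃-PARTNER) at a non-split X2b pair `(W, 3)` from the KERNEL DISCRIMINANT, character-free, PUBLISHED inputs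
only.** Data: `X2.CellB W 3`, `3` non-split; a rational `3`-line `Φ₀ ≤ W[3]`; an integer `D ≡ 1 (mod 4)` with `|D|`
squarefree (an ODD fundamental discriminant, or `D = 1`) and the kernel-discriminant property «`σ` fixes `Φ₀` pointwise
iff `σ√D = √D`» (the tree's `EisensteinKernelDiscriminant.exists_kernelDisc` shape; per pair `D` = squarefree part of
`4x₀³ + b₂x₀² + 2b₄x₀ + b₆` at a rational root `x₀` of `Ψ₃`, `exists_disc_of_mem`); finite `S₀ ∌ (3)` with `W` good
off `S₀ ∪ {3}`, `A ⊆ S₀` the additive places, `S₀ ∖ A` multiplicative; and ONE decidable identity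
`1 = Σ_{S₀∖A} s_ℓ[W split at v] + Σ_{v∈A} (0 if ℓ ∣ |D| | s_ℓ if ℓ % 3 = 2 | 2s_ℓ[J(ℓ | |D|) = 1])`
(`s_ℓ = 3^{v₃(ℓ²−1)−1}`, `J` = Mathlib's Jacobi symbol). The line character is w3 g8's explicit quadratic
Kronecker–Weber `exists_quadraticChar_geomSqrt_of_emod_four` (`χ(a) = J(a | |D|)`, `χ̄` primitive mod `|D|`), then §3.
Named facts BY NAME: `PublishedInputs`, Disegni Thm. 4(1) and Thm. 2.4, GV Thm. (3.11), Nakagawa–Horie–Taya — all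
PUBLISHED. Conditional; nothing about any curve is proved unconditionally. [cite: IrelandRosen1990, Ch. 6 Prop. 6.3.2]
[cite: Cox2013, §1.C Lemma 1.14] [cite: GreenbergVatsal2000, §2 Prop. (2.4), p. 28, §3 Thm. (3.11) and p. 43]
[cite: Disegni2020, §2.2 Thm. 2.4 and §3.2 Thm. 4] [cite: NakagawaHorie1988, Thm. 1] -/
theorem upperPartner_at_three_of_kernelDisc_of_padicGZ (hP : EisensteinPrimes.PublishedInputs)
    (hDis : padicBSD_rankOne_nonsplitMult) (h311 : thm311_hasUnitContent_iff_and_order_eq_of_lineRamifiedEven)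
    (hDGZ : padicGrossZagier_nonsplitMult)
    (hNH : Literature.NumberTheory.QuadraticFields.nakagawaHorie_taya_exists_imaginary_h3_eq_one)
    (W : WeierstrassCurve ℚ) [W.IsElliptic] [W.IsGloballyMinimal]
    (hc : X2.CellB W 3) (hns : ¬ W.HasSplitMultiplicativeReductionAtPrime 3)
    {Φ₀ : AddSubgroup (geomTorsion W (3 : ℤ))} (hΦ : IsRationalLine W 3 Φ₀)
    {D : ℤ} (hD4 : D % 4 = 1) (hsq : Squarefree D.natAbs) [NeZero D.natAbs]
    (hker : ∀ σ : absoluteGaloisGroup ℚ,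
      (∀ Q ∈ Φ₀, σ • Q = Q) ↔ σ • geomSqrt ((D : ℤ) : ℚ) = geomSqrt ((D : ℤ) : ℚ))
    (S₀ : Finset (HeightOneSpectrum (𝓞 ℚ))) (hS₀p : ∀ v ∈ S₀, ((3 : ℕ) : 𝓞 ℚ) ∉ v.asIdeal)
    (hS : ∀ v : HeightOneSpectrum (𝓞 ℚ), v ∉ S₀ → ((3 : ℕ) : 𝓞 ℚ) ∉ v.asIdeal → W.HasGoodReductionAt v)
    (A : Finset (HeightOneSpectrum (𝓞 ℚ))) (hAS : A ⊆ S₀) (hA : ∀ v ∈ A, W.HasAdditiveReductionAt v)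
    (hmult : ∀ v ∈ S₀, v ∉ A → W.HasMultiplicativeReductionAt v)
    (hbal : 1 = ∑ v ∈ S₀ \ A, (if W.HasSplitMultiplicativeReductionAt v
          then sFactor 3 (Rat.HeightOneSpectrum.natGenerator v) else 0) +
      ∑ v ∈ A, (if Rat.HeightOneSpectrum.natGenerator v ∣ D.natAbs then 0 else
        if Rat.HeightOneSpectrum.natGenerator v % 3 = 2 then sFactor 3 (Rat.HeightOneSpectrum.natGenerator v)
        else 2 * (if J((Rat.HeightOneSpectrum.natGenerator v : ℤ) | D.natAbs) = 1
          then sFactor 3 (Rat.HeightOneSpectrum.natGenerator v) else 0))) :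
    ∃ (K : Type) (_ : Field K) (_ : NumberField K), IsImaginaryQuadratic K ∧
      SatisfiesHeegnerHypothesis (W.conductorNorm ℤ) K ∧ SatisfiesHeegnerHypothesis 3 K ∧
      Odd (NumberField.discr K) ∧ NumberField.discr K < -4 ∧
      (W.quadraticTwist (NumberField.discr K : ℚ)).analyticRank = 1 ∧
      ∀ (Wd : WeierstrassCurve ℚ) [Wd.IsElliptic] [Wd.IsGloballyMinimal],
        (∃ C : VariableChange ℚ, C • Wd = W.quadraticTwist (NumberField.discr K : ℚ)) →
        MissingUpperBoundAt Wd 3 := by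
  haveI : Fact (Nat.Prime 3) := ⟨Nat.prime_three⟩
  obtain ⟨χ, hχ2, hprim, hval, hrad⟩ :=
    EisensteinPrimesMazurMCOnCellBTwistbackQuadraticRadical.exists_quadraticChar_geomSqrt_of_emod_four (p := 3)
      (by decide) hD4 hsq
  have hD0 : ((D : ℤ) : ℚ) ≠ 0 := by
    have : D ≠ 0 := by rintro rfl; simp at hD4
    exact_mod_cast this
  refine upperPartner_at_three_of_kernelRadical_of_padicGZ hP hDis h311 hDGZ hNH W hc hns hΦ χ hχ2 hprim
    (geomSqrt_ne_zero hD0) hrad hker S₀ hS₀p hS A hAS hA hmult ?_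
  rw [hbal]
  congr 1
  refine Finset.sum_congr rfl fun v _ ↦ ?_
  rw [hval]

end Summit.BirchSwinnertonDyer.BirchSwinnertonDyer.Theorems.EisensteinPrimesMazurMCOnCellBTwistbackSubrowLineCharBalance

end
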